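import Mathlib
import Literature.NumberTheory.Automorphic.ResGLnCohomology
import Literature.NumberTheory.Automorphic.CuspidalCohomologyGLRankOneProofs
import HarnessLib

/-!
# Rank-one eigenclasses in `H⁰(S_{K_f(𝔫)}, Ẽ_λ)` for `Res_{K/ℚ} GL₁`
# (stub `stub_glOne_eigenclass` of line `Sketch`)

Crux `HeckeEigenvalueField` (stmt-Langlands-13632), cohomological half of the rank-one (`n = 1`)
case of the realisation fact on the carrier `ResGLnCohomology.levelCohomology ℂ 1 K 𝔫 λ 0`.
For a number field `K`, a level `𝔫`, a weight `λ = (λ_τ)_{τ : K →+* ℂ}` and a character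
`χ : GL₁(𝔸_K^∞) → ℂˣ` which is trivial on `K_f(𝔫)` and satisfies
`χ(γ) = ∏_τ τ(det γ)^{λ_τ}` on the diagonally embedded `GL₁(K)⁺`, the class of the function
`c ↦ χ(c) · w₀` (`w₀ = ⊗_τ w_τ` a pure tensor of non-zero vectors of the lines `V_{λ_τ}(ℂ)`) is a
non-zero element of `H⁰(GL₁(K)⁺, Fun(GL₁(𝔸_K^∞)/K_f(𝔫), E_λ(ℂ)))` on which every Hecke operator
`T_g = [K_f(𝔫) g K_f(𝔫)]` acts by `χ(g)`.  This is the tree's generic engine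
`TwistedQuotient.exists_eigenclass_of_character` (commutative `𝒢`: here `GL₁(𝔸_K^∞)`, `1 × 1`
invertible matrices over a commutative ring), fed with:
* `GL₁(K)⁺` acts on `E_λ(ℂ) = ⊗_τ V_{λ_τ}(ℂ)` factorwise (`ResGLnCohomology.coeffRep_apply_tprod`),
  on the factor `τ` by `det(τ γ)^{λ_τ} = τ(det γ)^{λ_τ}` (`GLnCohomology.coeffRepGL_apply`,
  `GLnCohomology.weylRepCoeff_one_apply`: the Weyl part is trivial for `n = 1`), hence on the
  pure tensor `w₀` by the scalar `∏_τ τ(det γ)^{λ_τ} = χ(γ)` (`MultilinearMap.map_smul_univ`);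
* `w₀ ≠ 0`: a pure tensor of non-zero vectors of vector spaces is non-zero (evaluate the tensor
  product of dual vectors `f_τ`, `f_τ(w_τ) = 1`, Mathlib `PiTensorProduct.dualDistrib_apply`);
  non-zero vectors exist by `GLnCohomology.exists_ne_zero_coeffModule`.
[cite: RaghuramShahidi2010, §2.2]
-/

set_option linter.dupNamespace false -- project-wide: Summit.Langlands.Langlands is the mandated namespace

noncomputable section

open scoped Classical TensorProduct
open NumberField IsDedekindDomain CategoryTheory Literature.NumberTheory.Automorphic ResGLnCohomology
  BigHeckeGLn

namespace Summit.Langlands.Langlands.Theorems.HeckeEigenvalueField.Res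

/-- `GL₁(R)` is commutative for a commutative ring `R` (`1 × 1` invertible matrices). [folklore] -/
private theorem gl_fin_one_mul_comm {R : Type*} [CommRing R] (a b : GL (Fin 1) R) :
    a * b = b * a := by
  refine Units.ext (Matrix.ext fun i j => ?_)
  rw [Subsingleton.elim i 0, Subsingleton.elim j 0]
  simp [Matrix.mul_apply, mul_comm]

/-- A pure tensor `⊗_i m_i` of non-zero vectors of vector spaces over a field (finite index type)
is non-zero: the product `∏_i f_i(m_i) = 1` of dual vectors with `f_i(m_i) = 1` is the value on it
of the linear functional `PiTensorProduct.dualDistrib (⊗_i f_i)`. [folklore] -/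
private theorem piTensorProduct_tprod_ne_zero {k ι : Type*} [Field k] [Fintype ι]
    {M : ι → Type*} [∀ i, AddCommGroup (M i)] [∀ i, Module k (M i)] (m : ∀ i, M i)
    (hm : ∀ i, m i ≠ 0) : (PiTensorProduct.tprod k m : ⨂[k] i, M i) ≠ 0 := by
  choose f hf using fun i => Module.Projective.exists_dual_eq_one k (hm i)
  intro h
  have h1 : PiTensorProduct.dualDistrib (⨂ₜ[k] i, f i) (⨂ₜ[k] i, m i) = ∏ i, (f i) (m i) :=
    PiTensorProduct.dualDistrib_apply f m
  rw [h, map_zero, Finset.prod_eq_one fun i _ => hf i] at h1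
  exact zero_ne_one h1

/-- A pure tensor `⊗_τ w_τ ∈ E_λ(k)` of non-zero vectors `w_τ ∈ V_{λ_τ}(k)` is non-zero. [folklore] -/
private theorem coeffModule_tprod_ne_zero {k : Type} [Field k] {n : ℕ} {K : Type} [Field K]
    [NumberField K] [CharZero k] {lam : (K →+* k) → Fin n → ℤ}
    (w : ∀ τ : K →+* k, GLnCohomology.CoeffModule k n (lam τ)) (hw : ∀ τ, w τ ≠ 0) :
    CoeffModule.tprod w ≠ 0 := by
  intro h
  exact piTensorProduct_tprod_ne_zero (k := k) w hw h

/-- For `n = 1` the factor `V_{λ_τ}(ℂ)` of `E_λ(ℂ)` is a line on which `g ∈ GL₁(K)` acts (through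
`τ`) by the scalar `τ(det g)^{λ_τ(0)}` (`V_λ(g) = det(g)^{λ_{n-1}} S_μ(g)` with `S_μ` trivial).
[folklore] -/
private theorem coeffRepGL_one_map_apply {K : Type} [Field K] (lam : (K →+* ℂ) → Fin 1 → ℤ)
    (τ : K →+* ℂ) (g : GL (Fin 1) K) (w : GLnCohomology.CoeffModule ℂ 1 (lam τ)) :
    GLnCohomology.coeffRepGL ℂ 1 (lam τ) (Matrix.GeneralLinearGroup.map (τ : K →+* ℂ) g) w =
      (τ ((Matrix.GeneralLinearGroup.det g : Kˣ) : K)) ^ (lam τ 0) • w := by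
  rw [GLnCohomology.coeffRepGL_apply, GLnCohomology.weylRepCoeff_one_apply,
    Matrix.GeneralLinearGroup.map_det, GLnCohomology.lowestEntry_succ, Units.val_zpow_eq_zpow_val,
    Units.coe_map]
  rfl

/-- For `n = 1`, `γ ∈ GL₁(K)⁺` acts on the pure tensor `⊗_τ w_τ ∈ E_λ(ℂ)` by the scalar
`∏_τ τ(det γ)^{λ_τ(0)}`. [folklore] -/
private theorem coeffRepPos_one_tprod {K : Type} [Field K] (lam : (K →+* ℂ) → Fin 1 → ℤ)
    [NumberField K] (γ : glTotPos 1 K) (w : ∀ τ : K →+* ℂ, GLnCohomology.CoeffModule ℂ 1 (lam τ)) :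
    coeffRepPos ℂ 1 K lam γ (CoeffModule.tprod w) =
      (∏ τ : K →+* ℂ,
          (τ ((Matrix.GeneralLinearGroup.det (γ : GL (Fin 1) K) : Kˣ) : K)) ^ (lam τ 0)) •
        CoeffModule.tprod w := by
  rw [coeffRepPos_apply, coeffRep_apply_tprod]
  have key : (fun τ : K →+* ℂ => GLnCohomology.coeffRepGL ℂ 1 (lam τ)
      (Matrix.GeneralLinearGroup.map (τ : K →+* ℂ) (γ : GL (Fin 1) K)) (w τ)) =
      fun τ : K →+* ℂ =>
        (τ ((Matrix.GeneralLinearGroup.det (γ : GL (Fin 1) K) : Kˣ) : K)) ^ (lam τ 0) • w τ :=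
    funext fun τ => coeffRepGL_one_map_apply lam τ (γ : GL (Fin 1) K) (w τ)
  rw [key]
  exact (PiTensorProduct.tprod ℂ).map_smul_univ _ _

/-- **Stub A1 (cohomological side, rank one)** — a character `χ` of `GL₁(𝔸_K^∞)` trivial on
`K_f(𝔫)` and equal to `∏_τ τ(γ)^{λ_τ}` on `GL₁(K)⁺` (the action of `GL₁(K)⁺` on the line
`E_λ(ℂ) = ⊗_τ det^{λ_τ}`) gives the non-zero class of `c ↦ χ(c) w₀` in
`H⁰(S_{K_f(𝔫)}, Ẽ_λ) = levelCohomology ℂ 1 K 𝔫 λ 0` with `T_g x = χ(g) x` for every `g`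
(`TwistedQuotient.exists_eigenclass_of_character`, `GL₁` being commutative).
[cite: RaghuramShahidi2010, §2.2] -/
theorem stub_glOne_eigenclass :
    ∀ (K : Type) [Field K] [NumberField K] (𝔫 : Ideal (𝓞 K)) (lam : (K →+* ℂ) → Fin 1 → ℤ)
      (χ : FiniteAdelicGL 1 K →* ℂˣ),
      (∀ u ∈ level 1 K 𝔫, χ u = 1) →
      (∀ γ : glTotPos 1 K, ((χ (diagPos 1 K γ) : ℂˣ) : ℂ) =
        ∏ τ : K →+* ℂ,
          (τ ((Matrix.GeneralLinearGroup.det (γ : GL (Fin 1) K) : Kˣ) : K)) ^ (lam τ 0)) →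
      ∃ x : levelCohomology ℂ 1 K 𝔫 lam 0, x ≠ 0 ∧
        ∀ g : FiniteAdelicGL 1 K, heckeOp ℂ 1 K 𝔫 lam 0 g x = ((χ g : ℂˣ) : ℂ) • x := by
  intro K _ _ 𝔫 lam χ hL hΓ
  -- a pure tensor of non-zero vectors `w τ ∈ V_{λ_τ}(ℂ)`
  choose w hw using fun τ : K →+* ℂ => GLnCohomology.exists_ne_zero_coeffModule ℂ (lam τ)
  have hw₀ : CoeffModule.tprod w ≠ 0 := coeffModule_tprod_ne_zero w hw
  -- `GL₁(K)⁺` acts on it through `χ ∘ diagPos`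
  have hρ : ∀ γ : glTotPos 1 K, coeffRepPos ℂ 1 K lam γ (CoeffModule.tprod w) =
      ((χ (diagPos 1 K γ) : ℂˣ) : ℂ) • CoeffModule.tprod w := fun γ => by
    rw [coeffRepPos_one_tprod, hΓ γ]
  -- `GL₁(𝔸_K^∞)` is commutative
  have hcomm : ∀ a b : FiniteAdelicGL 1 K, a * b = b * a := fun a b => gl_fin_one_mul_comm a b
  obtain ⟨x, hx0, hx⟩ :=
    TwistedQuotient.exists_eigenclass_of_character (V := CoeffModule ℂ 1 K lam) (diagPos 1 K)
      (level 1 K 𝔫) (coeffRepPos ℂ 1 K lam) hcomm χ hL (CoeffModule.tprod w) hw₀ hρ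
  exact ⟨x, hx0, fun g => hx g⟩

end Summit.Langlands.Langlands.Theorems.HeckeEigenvalueField.Res

end
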